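import Literature.NumberTheory.Automorphic.RegularAlgebraicCuspidalHeckePointProofs
import Literature.NumberTheory.Automorphic.ModPHeckeEigensystemGL
import HarnessLib

/-!
# `TwoAdicBianchiProModularityLevel` (crux stmt-Langlands-15110, route `ParityBlindBianchi`),
# negative side — TWIST SYMMETRY of the points of `Spf 𝕋(Kᵖ)`

A character `ψ : 𝒢 →* kˣ` which is trivial on `ι(Γ)` and on every level `K(s)` of a tower (for
`Γ = GL₂(K) → 𝒢 = GL₂(𝔸_K^∞)`: `ψ = η ∘ det` for an idele class character `η` of finite order with
values in `k`, trivial on `det U`) acts on the coefficient representations `Fun(𝒢/K(s), k/ϖ^t)` by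
multiplication, `(τ_ψ f)(x) = ψ(x) f(x)` — a `Γ`-equivariant automorphism (`ψ ∘ ι = 1`), well
defined on cosets (`ψ|_{K(s)} = 1`) — and conjugating a double-coset operator by it rescales it:
`T_g ∘ τ_ψ = ψ(g) · τ_ψ ∘ T_g` (`heckeFun_twist`).  Passing to `H^i(X_{K(s)}, k/ϖ^t)` by functoriality
and to the big Hecke algebra through the kernel description of its points
(`isHeckePoint_iff_forall_freeAlgebra`), **the set of points of `Spf 𝕋(Kᵖ)` is stable under
`χ ↦ (j ↦ ψ(δ j) χ j)`** (`IsHeckePoint.twist`).  For the crux: if the Hansen data `a` of `σ` were a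
point at tame level `U`, so would be the data `(η(ϖ_v) a_{v,1}, η(ϖ_v)² a_{v,2})` of `σ ⊗ η` for every
finite-order `η` unramified at the good places with `η ∘ det` trivial on `U` — the formal shadow of
"`Spf 𝕋(U²)` is stable under twisting by characters of `U`-level", the symmetry every parity / descent
/ calibration argument about stub B (`stub_artinLift`) uses (cf. the reports of leads c4, c6, c7 in
`Cruxes/…/Lines/Sketch.md`).  Sorry-free and definition-free (the twist operators live inside the
proofs; statements mention only the explicit function `c ↦ ψ(c.out) • f c`).  Lead c8, line `Sketch`.
-/

noncomputable section

set_option linter.dupNamespace false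

namespace Summit.Langlands.Langlands.Theorems.TwoAdicBianchiProModularityLevel.Negative

open CategoryTheory Literature.NumberTheory.Automorphic

universe u v

section Twist

variable (k : Type u) [CommRing k] {Γ 𝒢 : Type u} [Group Γ] [Group 𝒢] (ι : Γ →* 𝒢)
  (L : Subgroup 𝒢) (M : Type u) [AddCommGroup M] [Module k M]

omit [Group Γ] in
/-- A character trivial on `L` is constant on left cosets: `ψ((gL).out) = ψ(g)`. [folklore] -/
theorem psi_out_mk (ψ : 𝒢 →* kˣ) (hL : ∀ l ∈ L, ψ l = 1) (g : 𝒢) :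
    ψ ((g : 𝒢 ⧸ L).out) = ψ g := by
  obtain ⟨l, hl⟩ := QuotientGroup.mk_out_eq_mul L g
  rw [hl, map_mul, hL l l.2, mul_one]

omit [Group Γ] in
/-- `ψ((x • c).out) = ψ(x) ψ(c.out)` for a character trivial on `L`. [folklore] -/
theorem psi_out_smul (ψ : 𝒢 →* kˣ) (hL : ∀ l ∈ L, ψ l = 1) (x : 𝒢) (c : 𝒢 ⧸ L) :
    ψ (x • c).out = ψ x * ψ c.out := by
  induction c using QuotientGroup.induction_on with
  | H y => rw [MulAction.Quotient.smul_coe, smul_eq_mul, psi_out_mk k L ψ hL, psi_out_mk k L ψ hL, map_mul]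

omit [Group Γ] in
/-- **Twisting rescales the Hecke operators**: for `ψ : 𝒢 →* kˣ` trivial on `L` and the twist
`(τ_ψ f)(c) = ψ(c) f(c)` of functions on `𝒢/L`, `[LgL](τ_ψ f) = ψ(g) · τ_ψ([LgL] f)` (every
`d ∈ LgL/L` has `ψ(x d) = ψ(x) ψ(g)`). [folklore] -/
theorem heckeFun_twist (ψ : 𝒢 →* kˣ) (hL : ∀ l ∈ L, ψ l = 1) (g : 𝒢) (f : (𝒢 ⧸ L) → M) :
    ArithmeticQuotient.heckeFun k L g M (fun c => ((ψ c.out : kˣ) : k) • f c) =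
      fun c => ((ψ g : kˣ) : k) • (((ψ c.out : kˣ) : k) • ArithmeticQuotient.heckeFun k L g M f c) := by
  classical
  funext c
  rw [ArithmeticQuotient.heckeFun_apply, ArithmeticQuotient.heckeFun_apply]
  split_ifs with h
  · rw [Finset.smul_sum, Finset.smul_sum]
    refine Finset.sum_congr rfl fun d hd => ?_
    obtain ⟨m, rfl⟩ := MulAction.mem_orbit_iff.mp ((Set.Finite.mem_toFinset h).mp hd)
    have hm : (m • (g : 𝒢 ⧸ L) : 𝒢 ⧸ L) = ((m : 𝒢) • (g : 𝒢 ⧸ L)) := rfl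
    rw [hm, psi_out_smul k L ψ hL, psi_out_smul k L ψ hL, psi_out_mk k L ψ hL, hL m m.2, one_mul,
      smul_smul ((ψ g : kˣ) : k) ((ψ c.out : kˣ) : k), ← Units.val_mul, mul_comm (ψ c.out) (ψ g)]
  · rw [smul_zero, smul_zero]

/-- The twist commutes with the `Γ`-action on `Fun(𝒢/L, M)` when `ψ ∘ ι = 1`. [folklore] -/
theorem coeffRepresentation_twist (ψ : 𝒢 →* kˣ) (hΓ : ∀ γ, ψ (ι γ) = 1) (hL : ∀ l ∈ L, ψ l = 1)
    (γ : Γ) (f : (𝒢 ⧸ L) → M) :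
    ArithmeticQuotient.coeffRepresentation k ι L M γ (fun c => ((ψ c.out : kˣ) : k) • f c) =
      fun c => ((ψ c.out : kˣ) : k) • ArithmeticQuotient.coeffRepresentation k ι L M γ f c := by
  funext c
  simp only [ArithmeticQuotient.coeffRepresentation_apply]
  rw [psi_out_smul k L ψ hL, map_inv, hΓ, inv_one, one_mul]

variable {L} (T : LevelTower 𝒢) (ϖ : k) {J : Type v} (δ : J → 𝒢) (χ : J → k)

/-- **Twist symmetry of `Spf 𝕋(Kᵖ)`.**  Let `ψ : 𝒢 →* kˣ` be a character trivial on `ι(Γ)` and on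
every level `K(s)` of the tower.  If `χ` is a point of the big Hecke algebra (`IsHeckePoint`), so is
its twist `j ↦ ψ(δ j) · χ j`.  Proof: the twists `τ_ψ, τ_{ψ⁻¹}` are mutually inverse `Γ`-equivariant
automorphisms of each `Fun(𝒢/K(s), k/ϖ^t)` with `T_g τ_ψ = ψ(g) τ_ψ T_g` (`heckeFun_twist`); on
`H^i(X_{K(s)}, k/ϖ^t)` they induce mutually inverse automorphisms `Φ, Φ'` with
`Φ' T_g Φ = ψ(g) T_g`, so for every non-commutative polynomial `P` in the `T_{δ j}`,
`P((ψ(δ j) T_{δ j})_j) = Φ' P((T_{δ j})_j) Φ` piece by piece; hence a relation `P(T) = 0` on finitely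
many pieces gives `P(ψ·T) = 0` there, and `P(ψ·χ) = (P ∘ s_ψ)(χ) ∈ (ϖ^t)` by the kernel description
of points (`isHeckePoint_iff_forall_freeAlgebra`). [folklore] -/
theorem IsHeckePoint.twist (ψ : 𝒢 →* kˣ) (hΓ : ∀ γ, ψ (ι γ) = 1)
    (hT : ∀ s, ∀ l ∈ T.level s, ψ l = 1) (h : IsHeckePoint ι T ϖ δ χ) :
    IsHeckePoint ι T ϖ δ (fun j => ((ψ (δ j) : kˣ) : k) * χ j) := by
  classical
  -- the twist endomorphisms of the coefficient representations, for any admissible character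
  have twist_exists : ∀ (φ : 𝒢 →* kˣ), (∀ γ, φ (ι γ) = 1) → (∀ s, ∀ l ∈ T.level s, φ l = 1) →
      ∀ z : TowerIndex, ∃ τ : ArithmeticQuotient.coeffRep k ι (T.level z.2.1) (modPow k ϖ z.2.2) ⟶
          ArithmeticQuotient.coeffRep k ι (T.level z.2.1) (modPow k ϖ z.2.2),
        ∀ f c, τ.hom f c = ((φ c.out : kˣ) : k) • f c := by
    intro φ hφΓ hφT z
    refine ⟨Rep.ofHom ⟨{ toFun := fun f c => ((φ c.out : kˣ) : k) • f c
                         map_add' := fun f f' => funext fun c => by simp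
                         map_smul' := fun r f => funext fun c => by simp [smul_comm r] }, fun γ => ?_⟩,
      fun f c => rfl⟩
    refine LinearMap.ext fun f => ?_
    exact (coeffRepresentation_twist k ι (T.level z.2.1) (modPow k ϖ z.2.2) φ hφΓ (hφT z.2.1) γ f).symm
  choose τ hτ using twist_exists ψ hΓ hT
  choose τ' hτ' using twist_exists ψ⁻¹ (fun γ => by rw [MonoidHom.inv_apply, hΓ, inv_one])
    (fun s l hl => by rw [MonoidHom.inv_apply, hT s l hl, inv_one])
  -- mutually inverse
  have hinv₁ : ∀ z, τ z ≫ τ' z = 𝟙 _ := fun z =>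
    Rep.hom_ext (Representation.IntertwiningMap.ext (LinearMap.ext fun f => funext fun c => by
      change (τ' z).hom ((τ z).hom f) c = f c
      rw [hτ', hτ, smul_smul, MonoidHom.inv_apply, Units.inv_mul, one_smul]))
  have hinv₂ : ∀ z, τ' z ≫ τ z = 𝟙 _ := fun z =>
    Rep.hom_ext (Representation.IntertwiningMap.ext (LinearMap.ext fun f => funext fun c => by
      change (τ z).hom ((τ' z).hom f) c = f c
      rw [hτ, hτ', smul_smul, MonoidHom.inv_apply, Units.mul_inv, one_smul]))
  -- Hecke compatibility on the coefficients: `τ ≫ T_g = ψ(g) • (T_g ≫ τ)`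
  have hhecke : ∀ (z : TowerIndex) (g : 𝒢),
      τ z ≫ ArithmeticQuotient.heckeRepHom k (T.level z.2.1) g (modPow k ϖ z.2.2) ι =
        ((ψ g : kˣ) : k) • (ArithmeticQuotient.heckeRepHom k (T.level z.2.1) g (modPow k ϖ z.2.2) ι ≫ τ z) :=
    fun z g => Rep.hom_ext (Representation.IntertwiningMap.ext (LinearMap.ext fun f => by
      change ArithmeticQuotient.heckeFun k (T.level z.2.1) g (modPow k ϖ z.2.2) ((τ z).hom f) =
        ((ψ g : kˣ) : k) • (τ z).hom (ArithmeticQuotient.heckeFun k (T.level z.2.1) g (modPow k ϖ z.2.2) f)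
      have h1 : (τ z).hom f = fun c => ((ψ c.out : kˣ) : k) • f c := funext fun c => hτ z f c
      have h2 : (τ z).hom (ArithmeticQuotient.heckeFun k (T.level z.2.1) g (modPow k ϖ z.2.2) f) =
          fun c => ((ψ c.out : kˣ) : k) •
            ArithmeticQuotient.heckeFun k (T.level z.2.1) g (modPow k ϖ z.2.2) f c := funext fun c => hτ z _ c
      rw [h1, h2, heckeFun_twist k (T.level z.2.1) (modPow k ϖ z.2.2) ψ (hT z.2.1) g f]
      rfl))
  -- on cohomology: the automorphisms `Φ z`, `Φ' z` and the conjugation identity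
  set Φ : ∀ z : TowerIndex, Module.End k (towerCohomology k ι T ϖ z.1 z.2.1 z.2.2) :=
    fun z => (groupCohomology.map (MonoidHom.id Γ) (τ z) z.1).hom with hΦ
  set Φ' : ∀ z : TowerIndex, Module.End k (towerCohomology k ι T ϖ z.1 z.2.1 z.2.2) :=
    fun z => (groupCohomology.map (MonoidHom.id Γ) (τ' z) z.1).hom with hΦ'
  have hΦinv₁ : ∀ z, Φ' z ∘ₗ Φ z = LinearMap.id := fun z => by
    simp only [hΦ, hΦ']
    rw [← ModuleCat.hom_comp, ← groupCohomology.map_id_comp, hinv₁, groupCohomology.map_id]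
    rfl
  have hΦinv₂ : ∀ z, Φ z ∘ₗ Φ' z = LinearMap.id := fun z => by
    simp only [hΦ, hΦ']
    rw [← ModuleCat.hom_comp, ← groupCohomology.map_id_comp, hinv₂, groupCohomology.map_id]
    rfl
  have hconj : ∀ (z : TowerIndex) (g : 𝒢),
      Φ' z ∘ₗ towerHeckeFamily k ι T ϖ g z ∘ₗ Φ z = ((ψ g : kˣ) : k) • towerHeckeFamily k ι T ϖ g z := by
    intro z g
    have h1 : towerHeckeFamily k ι T ϖ g z ∘ₗ Φ z = ((ψ g : kˣ) : k) • (Φ z ∘ₗ towerHeckeFamily k ι T ϖ g z) := by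
      have h0 : groupCohomology.map (A := ArithmeticQuotient.coeffRep k ι (T.level z.2.1) (modPow k ϖ z.2.2))
            (MonoidHom.id Γ)
            (τ z ≫ ArithmeticQuotient.heckeRepHom k (T.level z.2.1) g (modPow k ϖ z.2.2) ι) z.1 =
          groupCohomology.map (A := ArithmeticQuotient.coeffRep k ι (T.level z.2.1) (modPow k ϖ z.2.2))
            (MonoidHom.id Γ)
            (((ψ g : kˣ) : k) • (ArithmeticQuotient.heckeRepHom k (T.level z.2.1) g (modPow k ϖ z.2.2) ι ≫ τ z))
            z.1 := by
        rw [hhecke]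
      rw [groupCohomology.map_id_comp, groupCohomology_map_id_smul, groupCohomology.map_id_comp] at h0
      have h0' := congrArg ModuleCat.Hom.hom h0
      simp only [ModuleCat.hom_comp, ModuleCat.hom_smul] at h0'
      exact h0'
    rw [h1, LinearMap.comp_smul, ← LinearMap.comp_assoc, hΦinv₁, LinearMap.id_comp]
  -- the rescaling of the abstract Hecke algebra and the conjugation identity for all polynomials
  let sψ : FreeAlgebra k J →ₐ[k] FreeAlgebra k J :=
    FreeAlgebra.lift k fun j => ((ψ (δ j) : kˣ) : k) • FreeAlgebra.ι k j
  have hpoly : ∀ (P : FreeAlgebra k J) (z : TowerIndex),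
      FreeAlgebra.lift k (fun j => towerHeckeFamily k ι T ϖ (δ j)) (sψ P) z =
        Φ' z ∘ₗ FreeAlgebra.lift k (fun j => towerHeckeFamily k ι T ϖ (δ j)) P z ∘ₗ Φ z := by
    intro P z
    induction P using FreeAlgebra.induction with
    | grade0 r =>
      rw [AlgHom.commutes, AlgHom.commutes]
      change algebraMap k (Module.End k (towerCohomology k ι T ϖ z.1 z.2.1 z.2.2)) r =
        Φ' z ∘ₗ algebraMap k (Module.End k (towerCohomology k ι T ϖ z.1 z.2.1 z.2.2)) r ∘ₗ Φ z
      rw [Module.algebraMap_end_eq_smul_id, LinearMap.smul_comp, LinearMap.comp_smul, LinearMap.id_comp,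
        hΦinv₁]
    | grade1 j =>
      simp only [sψ, FreeAlgebra.lift_ι_apply, map_smul, Pi.smul_apply]
      rw [hconj]
    | add P Q hP hQ =>
      simp only [map_add, Pi.add_apply]
      rw [hP, hQ, LinearMap.add_comp, LinearMap.comp_add]
    | mul P Q hP hQ =>
      have hcancel : ∀ X : Module.End k (towerCohomology k ι T ϖ z.1 z.2.1 z.2.2),
          Φ z ∘ₗ (Φ' z ∘ₗ X) = X := fun X => by
        rw [← LinearMap.comp_assoc, hΦinv₂, LinearMap.id_comp]
      simp only [map_mul, Pi.mul_apply]
      rw [hP, hQ, Module.End.mul_eq_comp, Module.End.mul_eq_comp]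
      simp only [LinearMap.comp_assoc]
      rw [hcancel]
  have hval : ∀ P : FreeAlgebra k J,
      FreeAlgebra.lift k (fun j => ((ψ (δ j) : kˣ) : k) * χ j) P = FreeAlgebra.lift k χ (sψ P) := by
    intro P
    change _ = ((FreeAlgebra.lift k χ).comp sψ) P
    congr 1
    refine FreeAlgebra.hom_ext (funext fun j => ?_)
    simp [sψ]
  -- conclude by the kernel description of points
  rw [isHeckePoint_iff_forall_freeAlgebra] at h ⊢
  intro t
  obtain ⟨I, hI⟩ := h t
  refine ⟨I, fun P hP => ?_⟩
  rw [hval]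
  refine hI _ fun z hz => ?_
  rw [hpoly, hP z hz, LinearMap.zero_comp, LinearMap.comp_zero]

end Twist

/-! ### The crux's Hecke family: twisting by idele class characters of `U`-level -/

section Crux

open scoped NumberField
open IsDedekindDomain

variable (K : Type) [Field K] [NumberField K]

/-- The determinants of the crux's Hecke elements: `det (t_{v,1})_f = ϖ̂_v`, `det (t_{v,2})_f = ϖ̂_v²`
(`ϖ̂_v` the idele of `ϖ` at `v`, `1` elsewhere). [folklore] -/
theorem det_sndHom_heckeDiagAt (v : HeightOneSpectrum (𝓞 K)) (ϖ : (v.adicCompletion K)ˣ) (j : Fin 2) :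
    Matrix.GeneralLinearGroup.det (GLn.sndHom 2 K (heckeDiagAt 2 K v ϖ (j.val + 1))) =
      uniformizerIdele K v ϖ ^ (j.val + 1) := by
  refine Units.ext ?_
  rw [Matrix.GeneralLinearGroup.map_det, Units.coe_map, Matrix.GeneralLinearGroup.val_det_apply,
    heckeDiagAt, coe_glDiagonal, Matrix.det_diagonal, Units.val_pow_eq_pow_val]
  fin_cases j
  · simp [Fin.prod_univ_two, Units.coe_map]
    rfl
  · simp [Fin.prod_univ_two, Units.coe_map, pow_two]
    rfl

variable {k : Type} [CommRing k] (ϖ₀ : k) (T : LevelTower (GL (Fin 2) (FiniteAdeleRing (𝓞 K) K)))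
  {S : Type} (pl : S → HeightOneSpectrum (𝓞 K))
  (ϖ : ∀ v : HeightOneSpectrum (𝓞 K), (v.adicCompletion K)ˣ) (a : S → ℕ → k)

/-- **Twist symmetry for the crux's Hecke family.**  In the setting of the conclusion of
`TwoAdicBianchiProModularityLevel` — `Γ = GL₂(K) → 𝒢 = GL₂(𝔸_K^∞)` diagonally, ANY tower `T` (for the
crux `K(s) = U ∩ K((2)^s)`), the Hecke family `(v, i) ↦ (t_{v,i+1})_f` over a type `S` of places and
values `(v, i) ↦ a v (i+1)`: if `a` is a point of `Spf 𝕋` and `η` is a `kˣ`-valued character of the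
finite ideles which is trivial on `Kˣ` (an idele class character; automatically trivial on the
connected `ℂˣ`) and such that `η ∘ det` is trivial on every level (for the crux: `η` unramified at the
good places and of conductor absorbed by `U` at the bad ones — `U` is free over `S₀`), then the
twisted data `(η(ϖ̂_v) a_{v,1}, η(ϖ̂_v)² a_{v,2})` — the Hansen data of `σ ⊗ η` when `a` is that of
`σ` — is a point of `Spf 𝕋` as well. [folklore] -/
theorem crux_twist_symmetry (η : (FiniteAdeleRing (𝓞 K) K)ˣ →* kˣ)
    (hK : ∀ x : Kˣ, η (Units.map (algebraMap K (FiniteAdeleRing (𝓞 K) K) : K →* FiniteAdeleRing (𝓞 K) K) x) = 1)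
    (hU : ∀ s, ∀ g ∈ T.level s, η (Matrix.GeneralLinearGroup.det g) = 1)
    (hpt : IsHeckePoint
      (Matrix.GeneralLinearGroup.map (algebraMap K (FiniteAdeleRing (𝓞 K) K)) :
        GL (Fin 2) K →* GL (Fin 2) (FiniteAdeleRing (𝓞 K) K))
      T ϖ₀
      (fun j : S × Fin 2 => GLn.sndHom 2 K (heckeDiagAt 2 K (pl j.1) (ϖ (pl j.1)) (j.2.val + 1)))
      (fun j => a j.1 (j.2.val + 1))) :
    IsHeckePoint
      (Matrix.GeneralLinearGroup.map (algebraMap K (FiniteAdeleRing (𝓞 K) K)) :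
        GL (Fin 2) K →* GL (Fin 2) (FiniteAdeleRing (𝓞 K) K))
      T ϖ₀
      (fun j : S × Fin 2 => GLn.sndHom 2 K (heckeDiagAt 2 K (pl j.1) (ϖ (pl j.1)) (j.2.val + 1)))
      (fun j => ((η (uniformizerIdele K (pl j.1) (ϖ (pl j.1))) ^ (j.2.val + 1) : kˣ) : k) *
        a j.1 (j.2.val + 1)) := by
  have h := IsHeckePoint.twist k
    (Matrix.GeneralLinearGroup.map (algebraMap K (FiniteAdeleRing (𝓞 K) K)) :
      GL (Fin 2) K →* GL (Fin 2) (FiniteAdeleRing (𝓞 K) K))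
    T ϖ₀ (fun j : S × Fin 2 => GLn.sndHom 2 K (heckeDiagAt 2 K (pl j.1) (ϖ (pl j.1)) (j.2.val + 1)))
    (fun j => a j.1 (j.2.val + 1)) (η.comp Matrix.GeneralLinearGroup.det)
    (fun γ => by rw [MonoidHom.comp_apply, Matrix.GeneralLinearGroup.map_det]; exact hK _)
    (fun s g hg => hU s g hg) hpt
  have hχ : (fun j : S × Fin 2 => (((η.comp Matrix.GeneralLinearGroup.det)
        (GLn.sndHom 2 K (heckeDiagAt 2 K (pl j.1) (ϖ (pl j.1)) (j.2.val + 1))) : kˣ) : k) *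
          a j.1 (j.2.val + 1)) =
      fun j => ((η (uniformizerIdele K (pl j.1) (ϖ (pl j.1))) ^ (j.2.val + 1) : kˣ) : k) *
        a j.1 (j.2.val + 1) :=
    funext fun j => by rw [MonoidHom.comp_apply, det_sndHom_heckeDiagAt, map_pow]
  rw [hχ] at h
  exact h

end Crux

end Summit.Langlands.Langlands.Theorems.TwoAdicBianchiProModularityLevel.Negative

end
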